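import Mathlib
import HarnessLib

/-!
# Kill test `SurfaceTermination` (stmt-ResolutionOfSingularities-16488) — the anticanonical cycle under ONE point blow-up:
# `Z_K'² = Z_K² − 1` (lattice form)

Route `ResolutionOfSingularities/HomologicalConductor`, crux chain W4.4 (lead g25; KERNEL-g25 §2, LEMMA 25.6: along a Gorenstein
step of an eternal thread the degree `−Z_K²` grows by the number of base points blown up).  `[OURS]` — AI-formalised, weaker than
expert review; NOT a statement of the manuscript under review (Hironaka 2017); pure lattice algebra over a commutative ring `R`,
no resolutions.

SET-UP (hypothesis style, no new definitions: the four hypotheses `hold`, `hol`, `hlo`, `hll` describe `Q'`).  `Q : Matrix (Fin n) (Fin n) R` is the intersection form of an exceptional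
configuration `E₁,…,E_n`, `κ_j = K·E_j`, and `Z` the anticanonical cycle, `Q Z = −κ` (i.e. `(K + Z)·E_j = 0`).  Blowing up a point
of `E_{i₀}` lying on no other curve gives the configuration `E'_1,…,E'_n, F` with form `Q'` on `Fin (n+1)` (old indices via
`Fin.castSucc`, the new curve `F = Fin.last n`): `E'_{i₀}² = E_{i₀}² − 1`, `E'_{i₀}·F = 1`, `F² = −1`, all other entries
unchanged / zero; `κ'_{i₀} = κ_{i₀} + 1` (adjunction), `κ'_F = −1`; and `Z' = (Z, Z_{i₀} − 1)` (`= b^*Z − F`).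

* `blowup_mulVec_castSucc` / `blowup_mulVec_last` — `(Q'Z')_j = (QZ)_j − [j = i₀]`, `(Q'Z')_F = 1`;
* `blowup_mulVec_eq_neg` — hence `Q Z = −κ ⇒ Q' Z' = −κ'`: `Z' = b^*Z_K − F` IS the anticanonical cycle upstairs;
* `blowup_self_intersection` — `Z'ᵀ Q' Z' = Zᵀ Q Z − 1` (unconditionally): **each point blow-up on the support lowers `Z_K²` by
  exactly one**, i.e. raises the degree `−Z_K²` of the germ by one;
* `node_mulVec_castSucc` / `node_mulVec_last` / `node_self_intersection` — the same three facts for the blow-up of a NODE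
  `E_{i₀} ∩ E_{i₁}` (`Z' = (Z, Z_{i₀} + Z_{i₁} − 1)`); `iterate_sub_one` — bookkeeping over `r` blow-ups.
-/

-- single-problem summit: the doubled namespace component is forced
set_option linter.dupNamespace false

namespace Summit.ResolutionOfSingularities.ResolutionOfSingularities.Theorems.NoZeno.BlowupCanonicalCycle

open Matrix Finset

variable {R : Type*} [CommRing R] {n : ℕ}

/-- **Old rows of `Q'Z'`.**  With `Z' = (Z, Z_{i₀} − 1)`: `(Q' Z')_j = (Q Z)_j − [j = i₀]` for every old index `j`.
[this work; elementary] -/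
theorem blowup_mulVec_castSucc {Q : Matrix (Fin n) (Fin n) R} {i₀ : Fin n} {Q' : Matrix (Fin (n + 1)) (Fin (n + 1)) R}
    (hold : ∀ j l : Fin n, Q' j.castSucc l.castSucc = Q j l - if j = i₀ ∧ l = i₀ then 1 else 0)
    (hol : ∀ j : Fin n, Q' j.castSucc (Fin.last n) = if j = i₀ then 1 else 0)
    (Z : Fin n → R) (Z' : Fin (n + 1) → R)
    (hZ : ∀ j : Fin n, Z' j.castSucc = Z j) (hZn : Z' (Fin.last n) = Z i₀ - 1) (j : Fin n) :
    (Q' *ᵥ Z') j.castSucc = (Q *ᵥ Z) j - if j = i₀ then 1 else 0 := by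
  simp only [Matrix.mulVec, dotProduct, Fin.sum_univ_castSucc, hold, hol, hZ, hZn]
  by_cases hj : j = i₀
  · subst hj
    simp only [true_and, if_true, sub_mul, Finset.sum_sub_distrib, ite_mul, one_mul, zero_mul, Finset.sum_ite_eq',
      Finset.mem_univ]
    ring
  · simp [hj]

/-- **The new row of `Q'Z'`.**  `(Q' Z')_F = Z_{i₀} − (Z_{i₀} − 1) = 1`. [this work; elementary] -/
theorem blowup_mulVec_last {i₀ : Fin n} {Q' : Matrix (Fin (n + 1)) (Fin (n + 1)) R}
    (hlo : ∀ l : Fin n, Q' (Fin.last n) l.castSucc = if l = i₀ then 1 else 0)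
    (hll : Q' (Fin.last n) (Fin.last n) = -1)
    (Z : Fin n → R) (Z' : Fin (n + 1) → R)
    (hZ : ∀ j : Fin n, Z' j.castSucc = Z j) (hZn : Z' (Fin.last n) = Z i₀ - 1) :
    (Q' *ᵥ Z') (Fin.last n) = 1 := by
  simp only [Matrix.mulVec, dotProduct, Fin.sum_univ_castSucc, hlo, hll, hZ, hZn]
  simp only [ite_mul, one_mul, zero_mul, Finset.sum_ite_eq', Finset.mem_univ, if_true]
  ring

/-- **`b^*Z_K − F` is the anticanonical cycle upstairs.**  If `Q Z = −κ` (i.e. `(K + Z)·E_j = 0` for all `j`) then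
`Q' Z' = −κ'` with `κ'_j = κ_j + [j = i₀]` (`K'·E'_{i₀} = K·E_{i₀} + 1` by adjunction, `E'_{i₀}² = E_{i₀}² − 1`) and `κ'_F = −1`
(`K'·F = −1`). [this work; the numerical form of `K_{X'} = b^*K_X + F`, `Z_{K'} = b^*Z_K − F`] -/
theorem blowup_mulVec_eq_neg {Q : Matrix (Fin n) (Fin n) R} {i₀ : Fin n} {Q' : Matrix (Fin (n + 1)) (Fin (n + 1)) R}
    (hold : ∀ j l : Fin n, Q' j.castSucc l.castSucc = Q j l - if j = i₀ ∧ l = i₀ then 1 else 0)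
    (hol : ∀ j : Fin n, Q' j.castSucc (Fin.last n) = if j = i₀ then 1 else 0)
    (hlo : ∀ l : Fin n, Q' (Fin.last n) l.castSucc = if l = i₀ then 1 else 0)
    (hll : Q' (Fin.last n) (Fin.last n) = -1)
    (Z κ : Fin n → R) (hZK : Q *ᵥ Z = -κ) (Z' κ' : Fin (n + 1) → R)
    (hZ : ∀ j : Fin n, Z' j.castSucc = Z j) (hZn : Z' (Fin.last n) = Z i₀ - 1)
    (hκ : ∀ j : Fin n, κ' j.castSucc = κ j + if j = i₀ then 1 else 0) (hκn : κ' (Fin.last n) = -1) :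
    Q' *ᵥ Z' = -κ' := by
  funext a
  induction a using Fin.lastCases with
  | last => rw [blowup_mulVec_last hlo hll Z Z' hZ hZn, Pi.neg_apply, hκn, neg_neg]
  | cast j =>
    rw [blowup_mulVec_castSucc hold hol Z Z' hZ hZn j, Pi.neg_apply, hκ j]
    have h := congrFun hZK j
    rw [Pi.neg_apply] at h
    rw [h]
    ring

/-- **`Z'ᵀ Q' Z' = Zᵀ Q Z − 1`** for `Z' = (Z, Z_{i₀} − 1)` on the blown-up form — unconditionally (no use of `κ`).  With
`Z = Z_K` this is `Z_{K'}² = Z_K² − 1`: every point blow-up on the support of the anticanonical cycle raises the degree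
`−Z_K²` by exactly one (LEMMA 25.6 of KERNEL-g25: the degree of the next Gorenstein stage is `deg T_m + r_m`).
[this work; elementary] -/
theorem blowup_self_intersection {Q : Matrix (Fin n) (Fin n) R} {i₀ : Fin n} {Q' : Matrix (Fin (n + 1)) (Fin (n + 1)) R}
    (hold : ∀ j l : Fin n, Q' j.castSucc l.castSucc = Q j l - if j = i₀ ∧ l = i₀ then 1 else 0)
    (hol : ∀ j : Fin n, Q' j.castSucc (Fin.last n) = if j = i₀ then 1 else 0)
    (hlo : ∀ l : Fin n, Q' (Fin.last n) l.castSucc = if l = i₀ then 1 else 0)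
    (hll : Q' (Fin.last n) (Fin.last n) = -1)
    (Z : Fin n → R) (Z' : Fin (n + 1) → R)
    (hZ : ∀ j : Fin n, Z' j.castSucc = Z j) (hZn : Z' (Fin.last n) = Z i₀ - 1) :
    Z' ⬝ᵥ (Q' *ᵥ Z') = Z ⬝ᵥ (Q *ᵥ Z) - 1 := by
  rw [dotProduct, Fin.sum_univ_castSucc, blowup_mulVec_last hlo hll Z Z' hZ hZn, hZn]
  simp only [blowup_mulVec_castSucc hold hol Z Z' hZ hZn, hZ, mul_sub, Finset.sum_sub_distrib]
  rw [dotProduct]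
  simp only [mul_ite, mul_one, mul_zero, Finset.sum_ite_eq', Finset.mem_univ, if_true]
  ring

/-! ## Blow-up at a NODE `E_{i₀} ∩ E_{i₁}` (`i₀ ≠ i₁` intended; the identities below are formal in the indicators
`δ_l := [l = i₀] + [l = i₁]`): `E'_a·E'_b = E_a·E_b − δ_a δ_b`, `E'_a·F = δ_a`, `F² = −1`, `Z' = (Z, Z_{i₀} + Z_{i₁} − 1)`. -/

/-- **Old rows at a node blow-up**: `(Q'Z')_j = (QZ)_j − δ_j`. [this work; elementary] -/
theorem node_mulVec_castSucc {Q : Matrix (Fin n) (Fin n) R} {i₀ i₁ : Fin n} {Q' : Matrix (Fin (n + 1)) (Fin (n + 1)) R}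
    (hold : ∀ j l : Fin n, Q' j.castSucc l.castSucc =
      Q j l - ((if j = i₀ then 1 else 0) + (if j = i₁ then 1 else 0)) * ((if l = i₀ then 1 else 0) + (if l = i₁ then 1 else 0)))
    (hol : ∀ j : Fin n, Q' j.castSucc (Fin.last n) = (if j = i₀ then 1 else 0) + (if j = i₁ then 1 else 0))
    (Z : Fin n → R) (Z' : Fin (n + 1) → R)
    (hZ : ∀ j : Fin n, Z' j.castSucc = Z j) (hZn : Z' (Fin.last n) = Z i₀ + Z i₁ - 1) (j : Fin n) :
    (Q' *ᵥ Z') j.castSucc = (Q *ᵥ Z) j - ((if j = i₀ then 1 else 0) + (if j = i₁ then 1 else 0)) := by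
  simp only [Matrix.mulVec, dotProduct, Fin.sum_univ_castSucc, hold, hol, hZ, hZn, sub_mul, Finset.sum_sub_distrib]
  -- the correction term `Σ_l δ_j δ_l Z_l = δ_j (Z_{i₀} + Z_{i₁})`
  have hB : ∑ l : Fin n, ((if l = i₀ then (1 : R) else 0) + (if l = i₁ then 1 else 0)) * Z l = Z i₀ + Z i₁ := by
    simp only [add_mul, Finset.sum_add_distrib, ite_mul, one_mul, zero_mul, Finset.sum_ite_eq', Finset.mem_univ,
      if_true]
  have hcorr : ∑ l : Fin n, ((if j = i₀ then (1 : R) else 0) + (if j = i₁ then 1 else 0)) *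
      ((if l = i₀ then (1 : R) else 0) + (if l = i₁ then 1 else 0)) * Z l =
      ((if j = i₀ then (1 : R) else 0) + (if j = i₁ then 1 else 0)) * (Z i₀ + Z i₁) := by
    rw [← hB, Finset.mul_sum]
    exact Finset.sum_congr rfl fun l _ => mul_assoc _ _ _
  rw [hcorr]
  ring

/-- **The new row at a node blow-up**: `(Q'Z')_F = Z_{i₀} + Z_{i₁} − (Z_{i₀} + Z_{i₁} − 1) = 1`. [this work; elementary] -/
theorem node_mulVec_last {i₀ i₁ : Fin n} {Q' : Matrix (Fin (n + 1)) (Fin (n + 1)) R}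
    (hlo : ∀ l : Fin n, Q' (Fin.last n) l.castSucc = (if l = i₀ then 1 else 0) + (if l = i₁ then 1 else 0))
    (hll : Q' (Fin.last n) (Fin.last n) = -1)
    (Z : Fin n → R) (Z' : Fin (n + 1) → R)
    (hZ : ∀ j : Fin n, Z' j.castSucc = Z j) (hZn : Z' (Fin.last n) = Z i₀ + Z i₁ - 1) :
    (Q' *ᵥ Z') (Fin.last n) = 1 := by
  simp only [Matrix.mulVec, dotProduct, Fin.sum_univ_castSucc, hlo, hll, hZ, hZn, add_mul, Finset.sum_add_distrib,
    ite_mul, one_mul, zero_mul, Finset.sum_ite_eq', Finset.mem_univ, if_true]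
  ring

/-- **`Z'ᵀ Q' Z' = Zᵀ Q Z − 1` at a node blow-up** (`Z' = b^*Z − F = (Z, Z_{i₀} + Z_{i₁} − 1)`): blowing up a point where
two curves of the support of `Z_K` meet also lowers `Z_K²` by exactly one. [this work; elementary] -/
theorem node_self_intersection {Q : Matrix (Fin n) (Fin n) R} {i₀ i₁ : Fin n} {Q' : Matrix (Fin (n + 1)) (Fin (n + 1)) R}
    (hold : ∀ j l : Fin n, Q' j.castSucc l.castSucc =
      Q j l - ((if j = i₀ then 1 else 0) + (if j = i₁ then 1 else 0)) * ((if l = i₀ then 1 else 0) + (if l = i₁ then 1 else 0)))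
    (hol : ∀ j : Fin n, Q' j.castSucc (Fin.last n) = (if j = i₀ then 1 else 0) + (if j = i₁ then 1 else 0))
    (hlo : ∀ l : Fin n, Q' (Fin.last n) l.castSucc = (if l = i₀ then 1 else 0) + (if l = i₁ then 1 else 0))
    (hll : Q' (Fin.last n) (Fin.last n) = -1)
    (Z : Fin n → R) (Z' : Fin (n + 1) → R)
    (hZ : ∀ j : Fin n, Z' j.castSucc = Z j) (hZn : Z' (Fin.last n) = Z i₀ + Z i₁ - 1) :
    Z' ⬝ᵥ (Q' *ᵥ Z') = Z ⬝ᵥ (Q *ᵥ Z) - 1 := by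
  rw [dotProduct, Fin.sum_univ_castSucc, node_mulVec_last hlo hll Z Z' hZ hZn, hZn]
  simp only [node_mulVec_castSucc hold hol Z Z' hZ hZn, hZ, mul_sub, mul_add, Finset.sum_sub_distrib,
    Finset.sum_add_distrib]
  rw [dotProduct]
  simp only [mul_ite, mul_one, mul_zero, Finset.sum_ite_eq', Finset.mem_univ, if_true]
  ring

/-- **Iterated form (bookkeeping).**  If a quantity drops by one at each of `r` steps it drops by `r`: for a sequence
`d : ℕ → R` with `d (m+1) = d m − 1` for `m < r`, `d r = d 0 − r`.  (Used with `d m = Z_K²` after `m` support blow-ups: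
`deg T_{m+1} = deg T_m + r_m`.) [this work; elementary] -/
theorem iterate_sub_one (d : ℕ → R) (r : ℕ) (h : ∀ m, m < r → d (m + 1) = d m - 1) : d r = d 0 - r := by
  induction r with
  | zero => simp
  | succ r ih =>
    rw [h r (Nat.lt_succ_self r), ih fun m hm => h m (Nat.lt_succ_of_lt hm)]
    push_cast
    ring

end Summit.ResolutionOfSingularities.ResolutionOfSingularities.Theorems.NoZeno.BlowupCanonicalCycle
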